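import Summits.CriticalPhenomena.Ising3DConformalLimit.Theses.UnitLightCone
import Summits.CriticalPhenomena.Ising3DConformalLimit.Theorems.HyperoctahedralRPTwoPointKernelOfLimit
import HarnessLib
import HarnessLib.Audit.Check

/-!
# Birth skeleton (BC3) of crux `LightConeRoundness` — route UnitLightCone, item stmt-CriticalPhenomena-17169

Line `birth` = the route's own declared discharge of the crux (route header: "LightConeRoundness ⇐ the
model-blind lemma TwoPointLightConeRigidity (support stmt-17170) + the shared support TwoPointKernelOfLimit
(stmt-16807)"), with two sharpenings:

* the Ising-specific kernel facts `TwoPointKernelOfLimit` are NOT a stub: the verbatim statement is the landed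
  tree theorem `HyperoctahedralRPTwoPoint.twoPointKernelOfLimit_proof` (route HyperoctahedralRP, item stmt-1983,
  `Theorems/HyperoctahedralRPTwoPointKernelOfLimit.lean`), used as glue in the composition (window
  `1/2 ≤ Δ ≤ 1`, continuity and positivity off `0`, homogeneity of degree `-2Δ`, invariance under the nine
  lattice mirrors);
* the model-blind mechanism `TwoPointLightConeRigidity` is cut at its natural seam into the LEVER (STUB A: a unit
  light cone in the axis frame forces rotation invariance in the TRANSVERSE plane — Paley–Wiener on complexified
  latitude circles) and the CLOSING GEOMETRY (STUB B: transverse isotropy about one axis + the cubic mirrors force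
  full `O(3)` invariance). STUB A asks for the Källén–Lehmann representation in the AXIS frame only: the
  face-diagonal frame hypothesis of the crux is not needed (route review 2026-08-16, `ULC-review.md` §1, re-derived
  in `Lines/birth.md`: the tube `{Re x₀ > ‖Im (x₁,x₂)‖}` of the frame `e₀` covers the latitude phases `cos α > 0`
  at EVERY height and depth because `cosh β > |sinh β|`), so STUB A is a strengthening of the support's analytic
  core, not a restatement of it.

STATUS NOTE (honest bookkeeping, grounder evidence `LightConeRoundnessProof.lean` on the item, 2026-08-16T23:01Z):
the CONCLUSION of the crux — two-point isotropy of every non-degenerate translation-invariant scale-covariant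
pointwise limit of `criticalCorr 3` — is already a tree theorem, `HyperoctahedralRPTwoPoint.kernel_rotation_invariant`
(`Theorems/HyperoctahedralRPTwoPointLimitIsotropicHolds.lean`, items stmt-1979/1983/1984 of route HyperoctahedralRP,
X-ray/Mellin line), so the crux can be closed at once by
`intro ρ Δ S hρ hlim _ hnd htr hsc _ _ R x; exact kernel_rotation_invariant hρ hlim hnd htr hsc R x`
(that file is deliberately NOT imported here or in the BC3 probes). This skeleton records the route's OWN,
independent light-cone mechanism: its two stubs give a second proof of the same isotropy that uses the spectral
SUPPORT condition at speed one instead of nine-mirror reflection positivity rigidity.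

Stubs (the only `sorry`s of the file; statements restated verbatim):
* `stub_axialOfUnitCone`  — STUB A (L): `0 < Δ < 2`, `K` continuous and positive off `0`, homogeneous of degree
  `-2Δ`, nine-mirror invariant, with a unit-cone Källén–Lehmann representation in the frame `e₂`
  ⇒ `K x = K y` whenever `x₂ = y₂` and `‖x‖ = ‖y‖` (rotation invariance in the transverse plane).
* `stub_roundOfAxialCubic` — STUB B (S/M, elementary): nine-mirror invariance + transverse isotropy about `e₂`
  ⇒ `K (R x) = K x` for every linear isometry `R` (two axial symmetries about orthogonal axes meet on every sphere).

Composition: `LightConeRoundness_of : __Registered.stub_axialOfUnitCone → __Registered.stub_roundOfAxialCubic →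
Theses.UnitLightCone.LightConeRoundness` (sorry-free; `K := fun x => S 2 ![0, x]`, kernel facts from
`twoPointKernelOfLimit_proof`, `0 < Δ < 2` from the window by `linarith`), and `lightConeRoundness_skeleton` applies
it to the two `stub_…` literally (checks that statements, aliases and stubs agree). Device `__Registered` as in
`Cruxes/IsingLimitLightCone/Lines/birth.lean`: the hypotheses of `_of` are admissible BY NAME for
`#h21_check_skeleton`.

Disproof used: none — `ledger crux ls stmt-CriticalPhenomena-17169` lists no `Disproof.lean` and no landed
`Theorems/LightConeRoundness/Negative/*` (2026-08-17); the negatives index of the summit (11 refuted statements: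
Cardy / percolation / SAW items) has no light-cone, Källén–Lehmann or isotropy statement.
-/

noncomputable section

namespace Summit.CriticalPhenomena.Ising3DConformalLimit.Cruxes.LightConeRoundness.Birth

open Literature.Probability.LatticeModels

/-! ### The two statements of the line -/

/-- STATEMENT A — transverse isotropy from a unit light cone in the axis frame (the lever). For a kernel `K` on
`ℝ³` which is continuous and positive off `0`, homogeneous of degree `-2Δ` with `0 < Δ < 2`, invariant under the
nine lattice mirrors `e_i, e_i ± e_j`, and which admits a Källén–Lehmann representation in the frame `e₂`,
`K (a e₀ + b e₁ + t e₂) = ∫ cos (k₀ a + k₁ b) e^{-ω |t|} dμ (k, ω)` (`t ≠ 0`) by a positive measure `μ` giving no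
mass to the spacelike region `{ω < ‖k‖}` (unit light cone), `K` is invariant under rotations about `e₂`:
`K x = K y` whenever `x₂ = y₂` and `‖x‖ = ‖y‖`. -/
def AxialOfUnitCone : Prop :=
  ∀ (Δ : ℝ) (K : EuclideanSpace ℝ (Fin 3) → ℝ), 0 < Δ → Δ < 2 → ContinuousOn K {0}ᶜ →
    (∀ x, x ≠ 0 → 0 < K x) → (∀ c : ℝ, 0 < c → ∀ x, K (c • x) = c ^ (-(2 * Δ)) * K x) →
    (∀ n : EuclideanSpace ℝ (Fin 3), (∃ i j : Fin 3, i ≠ j ∧ (n = EuclideanSpace.single i 1 ∨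
        n = EuclideanSpace.single i 1 + EuclideanSpace.single j 1 ∨
        n = EuclideanSpace.single i 1 - EuclideanSpace.single j 1)) →
      ∀ x, K (((ℝ ∙ n)ᗮ).reflection x) = K x) →
    (∃ μ : MeasureTheory.Measure (EuclideanSpace ℝ (Fin 2) × ℝ),
      μ {p : EuclideanSpace ℝ (Fin 2) × ℝ | p.2 < ‖p.1‖} = 0 ∧
      (∀ t a b : ℝ, t ≠ 0 → K (EuclideanSpace.single 0 a + EuclideanSpace.single 1 b +
        EuclideanSpace.single 2 t) =
          ∫ p, Real.cos (p.1 0 * a + p.1 1 * b) * Real.exp (-(p.2 * |t|)) ∂μ)) →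
    ∀ x y : EuclideanSpace ℝ (Fin 3), x 2 = y 2 → ‖x‖ = ‖y‖ → K x = K y

/-- STATEMENT B — round from transverse-round and cubic (the closing geometry). A function on `ℝ³` invariant
under the nine lattice mirrors and under rotations about `e₂` (`K x = K y` whenever `x₂ = y₂`, `‖x‖ = ‖y‖`) is
invariant under every linear isometry. (The swap mirror `e₀ - e₂` conjugates the axial symmetry about `e₂` into
one about `e₀`; two axial symmetries about orthogonal axes connect any two points of a sphere.) -/
def RoundOfAxialCubic : Prop :=
  ∀ (K : EuclideanSpace ℝ (Fin 3) → ℝ),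
    (∀ n : EuclideanSpace ℝ (Fin 3), (∃ i j : Fin 3, i ≠ j ∧ (n = EuclideanSpace.single i 1 ∨
        n = EuclideanSpace.single i 1 + EuclideanSpace.single j 1 ∨
        n = EuclideanSpace.single i 1 - EuclideanSpace.single j 1)) →
      ∀ x, K (((ℝ ∙ n)ᗮ).reflection x) = K x) →
    (∀ x y : EuclideanSpace ℝ (Fin 3), x 2 = y 2 → ‖x‖ = ‖y‖ → K x = K y) →
    ∀ (R : EuclideanSpace ℝ (Fin 3) ≃ₗᵢ[ℝ] EuclideanSpace ℝ (Fin 3)) (x : EuclideanSpace ℝ (Fin 3)),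
      K (R x) = K x

/-! ### The registered stubs (the only `sorry`s of the file; statements restated verbatim) -/

/-- STUB A (L, model-blind) — `AxialOfUnitCone`: a unit light cone in the axis frame `e₂` (Källén–Lehmann
representation with no spacelike spectral weight) plus nine-mirror invariance and homogeneity of degree `-2Δ`,
`0 < Δ < 2`, makes a continuous positive kernel rotation invariant in the transverse plane. Plan (card
`Lines/birth.md`): transport the representation to the frames `e₀`, `e₁` by the swap mirrors; holomorphic
extension to the tubes `{Re x₀ > ‖Im (x₁, x₂)‖}` etc. with `|K| ≤ K ((Re x₀ - ‖Im x_⊥‖) e₀)` (dominated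
convergence, `ω ≥ ‖k‖`; no junk integral since `K > 0`); on the complexified latitude
`ψ ↦ K (s cos ψ, s sin ψ, c)` the four tubes `±e₀, ±e₁` cover `{cos (Re ψ) ≷ 0}`, `{sin (Re ψ) ≷ 0}` at every depth
(`cosh β > |sinh β|`), giving an entire `2π`-periodic function of exponential type `2Δ`; the quarter turn about
`e₂` (two mirrors) makes it `π/2`-periodic, and a `π/2`-periodic entire function of type `2Δ < 4` is constant
(tree: `Literature.Analysis.Complex.apply_eq_apply_of_periodic_of_norm_le_exp`). Why it might fail: only if the
tube bound or the gluing of the four local extensions (identity theorem on vertical strips) hides a gap; the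
type bound degenerates as `s → 0` (poles), where the statement is trivial. -/
theorem stub_axialOfUnitCone :
    ∀ (Δ : ℝ) (K : EuclideanSpace ℝ (Fin 3) → ℝ), 0 < Δ → Δ < 2 → ContinuousOn K {0}ᶜ →
      (∀ x, x ≠ 0 → 0 < K x) → (∀ c : ℝ, 0 < c → ∀ x, K (c • x) = c ^ (-(2 * Δ)) * K x) →
      (∀ n : EuclideanSpace ℝ (Fin 3), (∃ i j : Fin 3, i ≠ j ∧ (n = EuclideanSpace.single i 1 ∨
          n = EuclideanSpace.single i 1 + EuclideanSpace.single j 1 ∨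
          n = EuclideanSpace.single i 1 - EuclideanSpace.single j 1)) →
        ∀ x, K (((ℝ ∙ n)ᗮ).reflection x) = K x) →
      (∃ μ : MeasureTheory.Measure (EuclideanSpace ℝ (Fin 2) × ℝ),
        μ {p : EuclideanSpace ℝ (Fin 2) × ℝ | p.2 < ‖p.1‖} = 0 ∧
        (∀ t a b : ℝ, t ≠ 0 → K (EuclideanSpace.single 0 a + EuclideanSpace.single 1 b +
          EuclideanSpace.single 2 t) =
            ∫ p, Real.cos (p.1 0 * a + p.1 1 * b) * Real.exp (-(p.2 * |t|)) ∂μ)) →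
      ∀ x y : EuclideanSpace ℝ (Fin 3), x 2 = y 2 → ‖x‖ = ‖y‖ → K x = K y := by
  sorry

/-- STUB B (S/M, elementary, model-blind) — `RoundOfAxialCubic`: nine-mirror invariance plus rotation invariance
about `e₂` give invariance under all of `O(3)`. Plan: the mirror `e₀ - e₂` swaps the coordinates `0` and `2`, so `K`
is also axially symmetric about `e₀`; for `‖x‖ = ‖y‖ = r` move `x` (keeping `x₂`, `‖x‖`) to `(0, √(r²-x₂²), x₂)`
and `y` likewise, then compare the two through the axial symmetry about `e₀` (both have vanishing `0`-th
coordinate and norm `r`); finally `‖R x‖ = ‖x‖`. Why it might fail: it cannot (pure Euclidean geometry); the cost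
is the reflection formula for `(ℝ ∙ (e₀ - e₂))ᗮ` on `EuclideanSpace ℝ (Fin 3)`. -/
theorem stub_roundOfAxialCubic :
    ∀ (K : EuclideanSpace ℝ (Fin 3) → ℝ),
      (∀ n : EuclideanSpace ℝ (Fin 3), (∃ i j : Fin 3, i ≠ j ∧ (n = EuclideanSpace.single i 1 ∨
          n = EuclideanSpace.single i 1 + EuclideanSpace.single j 1 ∨
          n = EuclideanSpace.single i 1 - EuclideanSpace.single j 1)) →
        ∀ x, K (((ℝ ∙ n)ᗮ).reflection x) = K x) →
      (∀ x y : EuclideanSpace ℝ (Fin 3), x 2 = y 2 → ‖x‖ = ‖y‖ → K x = K y) →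
      ∀ (R : EuclideanSpace ℝ (Fin 3) ≃ₗᵢ[ℝ] EuclideanSpace ℝ (Fin 3)) (x : EuclideanSpace ℝ (Fin 3)),
        K (R x) = K x := by
  sorry

/-! ### Aliases keyed by the registered stub names (implementation detail for the native skeleton audit) -/
namespace __Registered

/-- Alias of `AxialOfUnitCone` keyed by the registered stub name. -/
abbrev stub_axialOfUnitCone : Prop := AxialOfUnitCone
/-- Alias of `RoundOfAxialCubic` keyed by the registered stub name. -/
abbrev stub_roundOfAxialCubic : Prop := RoundOfAxialCubic

end __Registered

/-! ### The composition (kernel-checked, no `sorry`) -/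

/-- **`LightConeRoundness` from the two stubs.** For a normalised, non-degenerate, translation-invariant,
scale-covariant pointwise limit `S` of `criticalCorr 3` put `K x := S 2 (0, x)`. The landed glue
`twoPointKernelOfLimit_proof` (HyperoctahedralRP, item stmt-1983; verbatim this route's support
`TwoPointKernelOfLimit`, stmt-16807) gives `1/2 ≤ Δ ≤ 1` (so `0 < Δ < 2`), continuity and positivity off `0`,
homogeneity of degree `-2Δ` and nine-mirror invariance of `K`; the crux's axis-frame Källén–Lehmann hypothesis is
passed to STUB A verbatim (the face-diagonal one and the normalisation are not needed); STUB B concludes. -/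
theorem LightConeRoundness_of (hA : __Registered.stub_axialOfUnitCone)
    (hB : __Registered.stub_roundOfAxialCubic) :
    Summit.CriticalPhenomena.Ising3DConformalLimit.Theses.UnitLightCone.LightConeRoundness := by
  intro ρ Δ S hρ hlim _hnorm hnd htr hsc hax _hdg R x
  obtain ⟨hΔ, hcont, hpos, hhom, hmirror⟩ :=
    Summit.CriticalPhenomena.Ising3DConformalLimit.HyperoctahedralRPTwoPoint.twoPointKernelOfLimit_proof
      ρ Δ S hρ hlim hnd htr hsc
  have haxial : ∀ x y : EuclideanSpace ℝ (Fin 3), x 2 = y 2 → ‖x‖ = ‖y‖ →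
      (fun z : EuclideanSpace ℝ (Fin 3) => S 2 ![0, z]) x = (fun z : EuclideanSpace ℝ (Fin 3) => S 2 ![0, z]) y :=
    hA Δ (fun z : EuclideanSpace ℝ (Fin 3) => S 2 ![0, z]) (by linarith [hΔ.1]) (by linarith [hΔ.2])
      hcont hpos hhom (fun n hn => (hmirror n hn).1) hax
  exact hB (fun z : EuclideanSpace ℝ (Fin 3) => S 2 ![0, z]) (fun n hn => (hmirror n hn).1) haxial R x

/-- The crux from the registered stubs (sorry-free itself; closed modulo the two `stub_…`; its type is literally
the route decl). Applying `LightConeRoundness_of` to the stubs checks that statements, aliases and stubs agree. -/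
theorem lightConeRoundness_skeleton :
    Summit.CriticalPhenomena.Ising3DConformalLimit.Theses.UnitLightCone.LightConeRoundness :=
  LightConeRoundness_of stub_axialOfUnitCone stub_roundOfAxialCubic

end Summit.CriticalPhenomena.Ising3DConformalLimit.Cruxes.LightConeRoundness.Birth

end

#h21_check_skeleton "stmt-CriticalPhenomena-17169" Summit.CriticalPhenomena.Ising3DConformalLimit.Theses.UnitLightCone.LightConeRoundness stub_axialOfUnitCone stub_roundOfAxialCubic
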